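import Summits.QuantumFields.BalabanUV.Beta.FP.SliceProjectorBloch
import Summits.QuantumFields.BalabanUV.Beta.GAN24.LatticeKernelConvolution

/-!
# `BalabanUV.Beta.FP.SliceProjectorKernel` — road «FP» (binder row D1), organisation γ, row **GAMMA-3 (d)** part 3∕5: **THE ROAD INSTANCE OF THE
# SLICE-PROJECTOR COMPLEMENT `(1 − Π)_N` ON `ℤ^D` AS A KERNEL** — the object `piC N x y`, its BLOCK READING through gen-8's symbol, COARSE-TRANSLATION
# COVARIANCE, the n-UNIFORM EXPONENTIAL LOCALISATION `‖piC N x y‖ ≤ CS(D)·N^{−D}·e^{−κ_Y‖blk x − blk y‖∞}`, and **IDEMPOTENCE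
# `Σ'_y piC N x y · piC N y z = piC N x z`** (it IS a projection kernel)

HONEST FRAMING (cell contract, verbatim): «discharging `BetaPertH` makes Bałaban's UV stability UNCONDITIONAL — a real constructive-QFT
result; it is NOT the continuum limit and NOT the Clay problem.»  HONEST DEPENDENCY (verbatim): «continuum YM on T⁴ ⇐ BetaPertH ∧ nine
spine estimates (0/9 proved); BetaPertH ⇐ (D1) ∧ (D4) ∧ CAP+tail; G-an2-4 gates asym, D1 and NE2/3/4.»  THIS MODULE DISCHARGES NOTHING of
D1 ∕ BetaPertH.  WHAT IT IS: the road's `1 − Π_N = Δ⁻¹Q′ᵀ(Q′Δ⁻²Q′ᵀ)⁻¹Q′Δ⁻¹` (B5 (1.27)–(1.28), (1.70) — the orthogonal projection of `ℓ²(ℤ^D)`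
onto `(Δ ker Q′_N)^⊥ = Δ⁻¹Q′_Nᵀ(coarse)`, `Q′_N` the block MEAN over the blocks `N•X + {0,…,N−1}^D`; normalisation-free since `A(AᵀA)⁻¹Aᵀ` is)
written HONESTLY on the infinite lattice, where the factor `Q′Δ⁻²Q′ᵀ` has no kernel at `D = 4` (infrared) but the composite does: its Bloch matrix
over the coarse momentum `k` is the EXACT rank-one alias projector `Aent(k) = (qa·e)⊗(qb·e)∕𝒩` of `FP/SliceProjectorEntries` (pole-free, the
`l = 0` singularities cancelled), and `piC N x y := N^{−D}·latticeKernel (S N (−y) (−x)) 0` with gen-8's `S` (`FP/SliceProjectorSymbol`).  Proofs: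
[folklore] Bloch bookkeeping — block regrouping (`SliceProjectorBlochChart.tsum_blocksN`) ∘ the `ℤ^D` CONVOLUTION THEOREM
(`GAN24.LatticeKernelConvolution.tsum_latticeKernel_mul` ✓ BY NAME) ∘ offset orthogonality + `Aent² = Aent` (`SliceProjectorBloch`) ∘
`B4Green244.latticeKernel_congr`∕`latticeKernel_sum_mul`; the decay is gen-8's END `SliceProjectorAliasSum.norm_latticeKernel_S_le_uniform` ✓
p246163 BY NAME.  [our object] data def `piC`; no `def … : Prop`; nothing is cited; 0 sorry.  NOT HERE (owner GO l.27277: «keep NOT HERE»): the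
B-jets (background derivatives) of `Π`, and the `ℓ²`-COMPLETENESS statement «range = all of `(Δ ker Q′)^⊥`» (Plancherel) — parts 3∕5–4∕5 give
projector + range ⊆ + kernel ⊇, which is what the model rows RHOA-11 ∕ GAMMA-4 ∕ GAMMA-5 consume.  NOT summit progress; NOT hbook, NOT D1,
NOT BetaPertH, NOT continuum, NOT Clay.

ABSOLUTE RULE (cell, verbatim): «No internally-minted statement may enter as a cited fact. Every hypothesis is either kernel-proved in this
package or a verbatim quotation of a PUBLISHED theorem with page reference. The manuscript(s) under audit are NOT citable for their own
disputed steps — they are the thing under adjudication; programme-internal (2001/route/tribunal) claims are never citable.»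

CONTENT (`D = d+1`, `N ≥ 1`):
* §5 [our object] **`piC`**; `S_neg_chart_row`, `S_neg_chart_col`; **`piC_chart`** (`piC N (N•X+a) (N•Y+b) = N^{−D}·latticeKernel (S N (−b) (−a)) (X−Y)`),
  `piC_eq_blk`, **`piC_translate`**, `abs_neg_finSite_le`, **`norm_piC_le`** (GAMMA-DESIGN §3's `|(1−Π)(u,u′)| ≤ Cn⁻⁴e^{−δ|u−u′|∕n}` at `D = 4`,
  zeroth B-jet, n-UNIFORM), `supNorm_sub_le_blkN`, **`norm_piC_le_fine`** (the same in fine distance: `≤ CS·e^{κ_Y}·N^{−D}·e^{−(κ_Y∕N)‖x−y‖∞}`).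
* §6 `ofRealVec_mem_Fat`, **`sum_S_mul_S`** (Bloch composition at the symbol level: `Σ_c S(−c,−x)·S(−z,−c) = N^D·S(−z,−x)` on the fat strip),
  `summable_prod_of_fintype`, `piC_chart_right`∕`piC_chart_left`, `summable_piC_mul_piC`, **`tsum_piC_mul_piC`** (IDEMPOTENCE).
Unit `b2b-balaban-beta-d1-formalise-leaf-06` (gen 9), road «FP» OWNER GO «THIS SHAPE» journal l.27277 (1) on INTENT l.27194; organisation γ (R-FP-25), row GAMMA-3 (d), under R-FP-33 (b)(c).
-/

noncomputable section

namespace Summit.QuantumFields.BalabanUV.Beta.FP.SliceProjectorKernel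

open Complex Finset MeasureTheory
open scoped BigOperators Real
open Literature.MathematicalPhysics.QuantumFieldTheory.Balaban1983to89
open B4Strip (Strip ofRealVec DeltaXi Delta1 shift U)
open B4StripCauchy (Fat rOf rOf_le strip_subset_fat)
open B5Strip145 (Ncal)
open B4ContourShift (BZ phase integrand fourierBox latticeKernel StripRegular supNorm ofRealVec_mem_Strip)
open B4Green244 (latticeKernel_congr latticeKernel_sum_mul)
open Beta.FibreInverseDecay (cphase)
open Summit.QuantumFields.BalabanUV.Beta.GAN24.FibreSymbols (pw pw_add)
open Summit.QuantumFields.BalabanUV.Beta.GAN24.AliasDecimate (aliasPt)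
open Summit.QuantumFields.BalabanUV.Beta.GAN24.LatticeKernelConvolution (tsum_latticeKernel_mul summable_latticeKernel_mul
  stripRegular_nonneg)
open Summit.QuantumFields.BalabanUV.Beta.FP.SliceProjectorMidInv (kapY kapY_pos)
open Summit.QuantumFields.BalabanUV.Beta.FP.SliceProjectorEntries (qa qb ew Aent qa_mul_qb strip_facts)
open Summit.QuantumFields.BalabanUV.Beta.FP.SliceProjectorSymbol (S)
open Summit.QuantumFields.BalabanUV.Beta.FP.SliceProjectorAliasSum (CS stripRegular_S norm_latticeKernel_S_le_uniform)
open Summit.QuantumFields.BalabanUV.Beta.FP.SliceProjectorBlochChart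
open Summit.QuantumFields.BalabanUV.Beta.FP.SliceProjectorBloch

variable {d : ℕ}

/-! ## §5 THE KERNEL `(1 − Π)_N (x, y)`: object, block reading, coarse-translation covariance, n-uniform exponential localisation -/

section Kernel

variable (N : ℕ) [NeZero N]

/-- [our object] **THE ROAD INSTANCE OF THE SLICE-PROJECTOR COMPLEMENT ON `ℤ^D`**:
`piC N x y := N^{−D} · latticeKernel (S N (−y) (−x)) 0` — the `(x, y)` entry of `1 − Π_N = Δ⁻¹Q′ᵀ(Q′Δ⁻²Q′ᵀ)⁻¹Q′Δ⁻¹` (B5 (1.27)–(1.28),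
(1.70)) for the block-MEAN `Q′` over the blocks `N•X + {0,…,N−1}^D` of `ℤ^D`, written through the Bloch symbol `S` of `FP/SliceProjectorSymbol`
(whose alias matrix `Aent` is the exact rank-one projector onto the alias vector of `Δ⁻¹Q′ᵀ`, §4). -/
def piC (x y : Fin (d + 1) → ℤ) : ℂ := (((N : ℂ) ^ (d + 1))⁻¹) * latticeKernel (fun k => S N (-y) (-x) k) 0

/-- [folklore] ROW READING of the symbol: the row variable `y = N•Y + b` leaves the block through a coarse character,
`S N (−(N•Y + b)) a′ k = S N (−b) a′ k · cphase (−Y) k`. -/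
theorem S_neg_chart_row (Y b a' : Fin (d + 1) → ℤ) (k : Fin (d + 1) → ℂ) :
    S N (-((N : ℤ) • Y + b)) a' k = S N (-b) a' k * cphase (-Y) k := by
  unfold S
  rw [Finset.sum_mul]
  refine Finset.sum_congr rfl fun l _ => ?_
  rw [Finset.sum_mul]
  refine Finset.sum_congr rfl fun l' _ => ?_
  rw [cphase_neg_chart_aliasPt]
  ring

/-- [folklore] COLUMN READING of the symbol: `S N b′ (−(N•X + a)) k = S N b′ (−a) k · cphase X k`. -/
theorem S_neg_chart_col (X a b' : Fin (d + 1) → ℤ) (k : Fin (d + 1) → ℂ) :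
    S N b' (-((N : ℤ) • X + a)) k = S N b' (-a) k * cphase X k := by
  unfold S
  rw [Finset.sum_mul]
  refine Finset.sum_congr rfl fun l _ => ?_
  rw [Finset.sum_mul]
  refine Finset.sum_congr rfl fun l' _ => ?_
  rw [neg_neg, neg_neg, cphase_chart_aliasPt]
  ring

/-- [our object] **BLOCK READING OF THE KERNEL**: `piC N (N•X + a) (N•Y + b) = N^{−D} · latticeKernel (S N (−b) (−a)) (X − Y)` — the entry
at fine points read as (block, offset) is the COARSE lattice kernel of gen-8's symbol at the block difference. -/
theorem piC_chart (X a Y b : Fin (d + 1) → ℤ) :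
    piC N ((N : ℤ) • X + a) ((N : ℤ) • Y + b) = (((N : ℂ) ^ (d + 1))⁻¹) * latticeKernel (fun k => S N (-b) (-a) k) (X - Y) := by
  have h : (fun k => S N (-((N : ℤ) • Y + b)) (-((N : ℤ) • X + a)) k) = fun k => S N (-b) (-a) k * cphase (X - Y) k := by
    funext k
    rw [S_neg_chart_row, S_neg_chart_col, sub_eq_add_neg, show cphase (X + -Y) k = cphase X k * cphase (-Y) k from pw_add k X (-Y)]
    ring
  unfold piC
  rw [h, latticeKernel_mul_cphase_zero]

/-- [our object] the same with the canonical chart `x = N•blk(x) + loc(x)`: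
`piC N x y = N^{−D} · latticeKernel (S N (−loc y) (−loc x)) (blk x − blk y)`. -/
theorem piC_eq_blk (x y : Fin (d + 1) → ℤ) :
    piC N x y = (((N : ℂ) ^ (d + 1))⁻¹)
      * latticeKernel (fun k => S N (-(finSite N (locN N y))) (-(finSite N (locN N x))) k) (blkN N x - blkN N y) := by
  conv_lhs => rw [← chart_blkN_locN N x, ← chart_blkN_locN N y]
  exact piC_chart N _ _ _ _

/-- [our object] **COARSE-TRANSLATION COVARIANCE**: `piC N (N•Z + x) (N•Z + y) = piC N x y`. -/
theorem piC_translate (Z x y : Fin (d + 1) → ℤ) : piC N ((N : ℤ) • Z + x) ((N : ℤ) • Z + y) = piC N x y := by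
  rw [piC_chart, sub_self]
  rfl

omit [NeZero N] in
/-- [folklore] offsets are at most `N` in absolute value: `|−(loc x)_μ| ≤ N`. -/
theorem abs_neg_finSite_le (c : Fin (d + 1) → Fin N) (μ : Fin (d + 1)) : |(-(finSite N c)) μ| ≤ N := by
  simp only [Pi.neg_apply, finSite, abs_neg, Nat.abs_cast]
  exact_mod_cast (c μ).isLt.le

/-- [our object] **THE KERNEL IS EXPONENTIALLY LOCALISED ON THE COARSE SCALE, UNIFORMLY IN `N`**:
`‖piC N x y‖ ≤ CS(D) · N^{−D} · e^{−κ_Y·‖blk x − blk y‖∞}` (every `D = d+1`, every `N ≥ 1`; `CS`, `κ_Y = kapY D` dimension-only,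
gen-8 `SliceProjectorAliasSum.norm_latticeKernel_S_le_uniform` BY NAME) — GAMMA-DESIGN §3's `|(1−Π)(u,u′)| ≤ C n⁻⁴ e^{−δ|u−u′|∕n}` at `D = 4`,
zeroth B-jet. -/
theorem norm_piC_le (x y : Fin (d + 1) → ℤ) :
    ‖piC N x y‖ ≤ CS d * ((N : ℝ) ^ (d + 1))⁻¹ * Real.exp (-(kapY (d + 1) * supNorm (blkN N x - blkN N y))) := by
  rw [piC_eq_blk, norm_mul, norm_inv, norm_pow, Complex.norm_natCast]
  have h := norm_latticeKernel_S_le_uniform N (abs_neg_finSite_le N (locN N y)) (abs_neg_finSite_le N (locN N x))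
    (blkN N x - blkN N y)
  calc ((N : ℝ) ^ (d + 1))⁻¹ * ‖latticeKernel (fun k => S N (-finSite N (locN N y)) (-finSite N (locN N x)) k) (blkN N x - blkN N y)‖
      ≤ ((N : ℝ) ^ (d + 1))⁻¹ * (CS d * Real.exp (-(kapY (d + 1) * supNorm (blkN N x - blkN N y)))) :=
        mul_le_mul_of_nonneg_left h (by positivity)
    _ = _ := by ring

/-- [folklore] fine distance versus block distance: `‖x − y‖∞ ≤ N·‖blk x − blk y‖∞ + (N − 1)`. -/
theorem supNorm_sub_le_blkN (x y : Fin (d + 1) → ℤ) :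
    supNorm (x - y) ≤ (N : ℝ) * supNorm (blkN N x - blkN N y) + ((N : ℝ) - 1) := by
  obtain ⟨i, hi⟩ := B4ContourShift.exists_supNorm_eq (x - y)
  rw [hi]
  have hx := congrFun (chart_blkN_locN N x) i
  have hy := congrFun (chart_blkN_locN N y) i
  simp only [Pi.add_apply, Pi.smul_apply, smul_eq_mul, finSite] at hx hy
  have hlx : ((locN N x i : ℕ) : ℤ) < N := by exact_mod_cast (locN N x i).isLt
  have hly : ((locN N y i : ℕ) : ℤ) < N := by exact_mod_cast (locN N y i).isLt
  have hlx0 : (0 : ℤ) ≤ ((locN N x i : ℕ) : ℤ) := by positivity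
  have hly0 : (0 : ℤ) ≤ ((locN N y i : ℕ) : ℤ) := by positivity
  have hb : ((|(blkN N x - blkN N y) i| : ℤ) : ℝ) ≤ supNorm (blkN N x - blkN N y) := B4ContourShift.abs_le_supNorm _ i
  have hN0 : (0 : ℝ) ≤ N := Nat.cast_nonneg N
  have key : (|(x - y) i| : ℤ) ≤ (N : ℤ) * |(blkN N x - blkN N y) i| + ((N : ℤ) - 1) := by
    rw [Pi.sub_apply, Pi.sub_apply, show x i - y i = (N : ℤ) * (blkN N x i - blkN N y i) + (((locN N x i : ℕ) : ℤ) - ((locN N y i : ℕ) : ℤ)) by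
      linarith]
    refine (abs_add_le _ _).trans ?_
    rw [abs_mul, Nat.abs_cast]
    have : |((locN N x i : ℕ) : ℤ) - ((locN N y i : ℕ) : ℤ)| ≤ (N : ℤ) - 1 := by rw [abs_le]; constructor <;> omega
    linarith
  have key' : (((|(x - y) i| : ℤ) : ℝ)) ≤ (N : ℝ) * (((|(blkN N x - blkN N y) i| : ℤ) : ℝ)) + ((N : ℝ) - 1) := by exact_mod_cast key
  nlinarith

/-- [our object] **THE SAME BOUND IN FINE-LATTICE DISTANCE** (the currency of the road's windowed letters, e.g. `SliceLoopPairing`'s `e^{−(δ∕n)‖·‖∞}`):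
`‖piC N x y‖ ≤ CS(D)·e^{κ_Y} · N^{−D} · e^{−(κ_Y∕N)·‖x − y‖∞}`. -/
theorem norm_piC_le_fine (x y : Fin (d + 1) → ℤ) :
    ‖piC N x y‖ ≤ CS d * Real.exp (kapY (d + 1)) * ((N : ℝ) ^ (d + 1))⁻¹ * Real.exp (-(kapY (d + 1) / N) * supNorm (x - y)) := by
  have hκ := (kapY_pos (d + 1)).le
  have hN1 : (1 : ℝ) ≤ N := by exact_mod_cast Nat.one_le_iff_ne_zero.mpr (NeZero.ne N)
  have hN0 : (0 : ℝ) < N := by linarith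
  have hCS : 0 ≤ CS d := by
    have := Summit.QuantumFields.BalabanUV.Beta.FP.SliceProjectorAliasSum.cN_pos d
    unfold CS; positivity
  refine (norm_piC_le N x y).trans ?_
  have hs := supNorm_sub_le_blkN N x y
  have hsb := B4ContourShift.supNorm_nonneg (blkN N x - blkN N y)
  have hexp : Real.exp (-(kapY (d + 1) * supNorm (blkN N x - blkN N y)))
      ≤ Real.exp (kapY (d + 1)) * Real.exp (-(kapY (d + 1) / N) * supNorm (x - y)) := by
    rw [← Real.exp_add]
    apply Real.exp_le_exp.mpr
    have h1 : kapY (d + 1) / N * supNorm (x - y) ≤ kapY (d + 1) / N * ((N : ℝ) * supNorm (blkN N x - blkN N y) + ((N : ℝ) - 1)) :=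
      mul_le_mul_of_nonneg_left hs (div_nonneg hκ hN0.le)
    have h2 : kapY (d + 1) / N * ((N : ℝ) * supNorm (blkN N x - blkN N y) + ((N : ℝ) - 1))
        = kapY (d + 1) * supNorm (blkN N x - blkN N y) + kapY (d + 1) * (((N : ℝ) - 1) / N) := by
      field_simp
    have h3 : kapY (d + 1) * (((N : ℝ) - 1) / N) ≤ kapY (d + 1) :=
      mul_le_of_le_one_right hκ (by rw [div_le_one hN0]; linarith)
    linarith
  calc CS d * ((N : ℝ) ^ (d + 1))⁻¹ * Real.exp (-(kapY (d + 1) * supNorm (blkN N x - blkN N y)))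
      ≤ CS d * ((N : ℝ) ^ (d + 1))⁻¹ * (Real.exp (kapY (d + 1)) * Real.exp (-(kapY (d + 1) / N) * supNorm (x - y))) :=
        mul_le_mul_of_nonneg_left hexp (by positivity)
    _ = _ := by ring

end Kernel

/-! ## §6 IDEMPOTENCE `Σ'_y (1−Π)(x,y)·(1−Π)(y,z) = (1−Π)(x,z)` (block regrouping ∘ convolution theorem ∘ offset orthogonality ∘ `Aent² = Aent`) -/

section Idempotence

variable (N : ℕ) [NeZero N]

/-- [folklore] real momenta of the Brillouin zone lie in the fat strip where `qa·qb = U` and the shifted symbols do not vanish. -/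
theorem ofRealVec_mem_Fat {p : Fin (d + 1) → ℝ} (hp : p ∈ BZ (d + 1)) : ofRealVec p ∈ Fat (d + 1) (rOf (d + 1)) :=
  (strip_facts (ofRealVec_mem_Strip (kapY_pos (d + 1)).le hp)).1

/-- [folklore] **THE BLOCH COMPOSITION RULE AT THE SYMBOL LEVEL**: summed over the intermediate offset, two copies of `S` compose to `N^D·S`:
`Σ_{c} S N (−c) (−x) k · S N (−z) (−c) k = N^D · S N (−z) (−x) k` on the fat strip (rank one × orthogonality × `𝒩 = Σ U e²`). -/
theorem sum_S_mul_S {k : Fin (d + 1) → ℂ} (hk : k ∈ Fat (d + 1) (rOf (d + 1))) (x z : Fin (d + 1) → ℤ) :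
    ∑ c : Fin (d + 1) → Fin N, S N (-(finSite N c)) (-x) k * S N (-z) (-(finSite N c)) k = ((N : ℂ) ^ (d + 1)) * S N (-z) (-x) k := by
  have horth : ∑ c : Fin (d + 1) → Fin N, Ra N (-(finSite N c)) k * Rb N (-(finSite N c)) k = ((N : ℂ) ^ (d + 1)) * Ncal N k := by
    calc ∑ c : Fin (d + 1) → Fin N, Ra N (-(finSite N c)) k * Rb N (-(finSite N c)) k
        = ∑ l : Fin (d + 1) → Fin N, ∑ l' : Fin (d + 1) → Fin N, (qa N l k * ew N l k) * (qb N l' k * ew N l' k)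
            * ∑ c : Fin (d + 1) → Fin N, cphase (-(finSite N c)) (aliasPt N l k) * cphase (finSite N c) (aliasPt N l' k) := by
          unfold Ra Rb
          simp_rw [Finset.sum_mul_sum, neg_neg, Finset.mul_sum]
          rw [Finset.sum_comm]
          refine Finset.sum_congr rfl fun l _ => ?_
          rw [Finset.sum_comm]
          refine Finset.sum_congr rfl fun l' _ => Finset.sum_congr rfl fun c _ => by ring
      _ = ((N : ℂ) ^ (d + 1)) * ∑ l : Fin (d + 1) → Fin N, U N l k * ew N l k ^ 2 := by
          simp_rw [sum_cphase_finSite, mul_ite, mul_zero, Finset.sum_ite_eq, Finset.mem_univ, if_true]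
          rw [Finset.mul_sum]
          refine Finset.sum_congr rfl fun l _ => ?_
          rw [← qa_mul_qb N (rOf_le (d + 1)) hk l]
          ring
      _ = ((N : ℂ) ^ (d + 1)) * Ncal N k := by rw [← Ncal_eq_sum_U_mul_ew_sq]
  by_cases hN : Ncal N k = 0
  · simp [S_eq_Ra_mul_Rb, hN]
  calc ∑ c : Fin (d + 1) → Fin N, S N (-(finSite N c)) (-x) k * S N (-z) (-(finSite N c)) k
      = (Rb N (-x) k * Ra N (-z) k / Ncal N k ^ 2) * ∑ c : Fin (d + 1) → Fin N, Ra N (-(finSite N c)) k * Rb N (-(finSite N c)) k := by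
        rw [Finset.mul_sum]
        refine Finset.sum_congr rfl fun c _ => ?_
        rw [S_eq_Ra_mul_Rb, S_eq_Ra_mul_Rb]
        field_simp
    _ = ((N : ℂ) ^ (d + 1)) * S N (-z) (-x) k := by
        rw [horth, S_eq_Ra_mul_Rb]
        field_simp

/-- [folklore] summability over `ℤ^D × (finite)` from summability of each slice. -/
theorem summable_prod_of_fintype {β : Type*} [Fintype β] [DecidableEq β] {g : (Fin (d + 1) → ℤ) × β → ℂ}
    (h : ∀ b, Summable fun a => g (a, b)) : Summable g := by
  have hdec : g = fun p => ∑ b : β, (if p.2 = b then g p else 0) := by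
    funext p; rw [Finset.sum_ite_eq Finset.univ p.2, if_pos (Finset.mem_univ _)]
  rw [hdec]
  refine summable_sum fun b _ => ?_
  have hinj : Function.Injective (fun a : Fin (d + 1) → ℤ => (a, b)) := fun a a' h => (Prod.mk.inj h).1
  refine (hinj.summable_iff ?_).mp ?_
  · intro p hp
    have : p.2 ≠ b := by
      intro hb; apply hp; exact ⟨p.1, by ext <;> simp [hb]⟩
    simp [this]
  · convert h b using 1
    funext a
    simp

/-- [our object] **THE TWO READINGS OF A MIDDLE POINT**: for `y = N•Y + c`,
`piC N x y = N^{−D}·latticeKernel (S N (−c) (−x)) (−Y)` and `piC N y z = N^{−D}·latticeKernel (S N (−z) (−c)) Y`. -/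
theorem piC_chart_right (x Y c : Fin (d + 1) → ℤ) :
    piC N x ((N : ℤ) • Y + c) = (((N : ℂ) ^ (d + 1))⁻¹) * latticeKernel (fun k => S N (-c) (-x) k) (-Y) := by
  unfold piC
  simp_rw [S_neg_chart_row]
  rw [latticeKernel_mul_cphase_zero]

/-- [our object] (second reading, see `piC_chart_right`). -/
theorem piC_chart_left (Y c z : Fin (d + 1) → ℤ) :
    piC N ((N : ℤ) • Y + c) z = (((N : ℂ) ^ (d + 1))⁻¹) * latticeKernel (fun k => S N (-z) (-c) k) Y := by
  unfold piC
  simp_rw [S_neg_chart_col]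
  rw [latticeKernel_mul_cphase_zero]

/-- [folklore] summability of the composition summand `y ↦ piC N x y · piC N y z`. -/
theorem summable_piC_mul_piC (x z : Fin (d + 1) → ℤ) : Summable fun y => piC N x y * piC N y z := by
  classical
  rw [← (blockEquivN (d := d) N).summable_iff]
  refine summable_prod_of_fintype fun c => ?_
  show Summable fun Y => piC N x ((N : ℤ) • Y + finSite N c) * piC N ((N : ℤ) • Y + finSite N c) z
  simp_rw [piC_chart_right, piC_chart_left]
  have h := summable_latticeKernel_mul (stripRegular_S N (-(finSite N c)) (-x)) (stripRegular_S N (-z) (-(finSite N c)))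
    (kapY_pos (d + 1)) 0
  simp_rw [zero_sub] at h
  refine (h.mul_left ((((N : ℂ) ^ (d + 1))⁻¹) * (((N : ℂ) ^ (d + 1))⁻¹))).congr fun Y => ?_
  ring

/-- [our object] **IDEMPOTENCE — `(1 − Π)_N` IS A PROJECTION KERNEL**: `Σ'_{y ∈ ℤ^D} piC N x y · piC N y z = piC N x z`. -/
theorem tsum_piC_mul_piC (x z : Fin (d + 1) → ℤ) : ∑' y, piC N x y * piC N y z = piC N x z := by
  classical
  have hκ := kapY_pos (d + 1)
  set C : ℂ := ((N : ℂ) ^ (d + 1))⁻¹ with hC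
  have hNC : ((N : ℂ) ^ (d + 1)) ≠ 0 := pow_ne_zero _ (Nat.cast_ne_zero.mpr (NeZero.ne N))
  -- block regrouping
  rw [tsum_blocksN N (summable_piC_mul_piC N x z)]
  -- each block term through the two readings and the convolution theorem
  have hblock : ∀ c : Fin (d + 1) → Fin N,
      ∑' Y : Fin (d + 1) → ℤ, piC N x ((N : ℤ) • Y + finSite N c) * piC N ((N : ℤ) • Y + finSite N c) z
        = C * C * latticeKernel (fun k => S N (-(finSite N c)) (-x) k * S N (-z) (-(finSite N c)) k) 0 := by
    intro c
    simp_rw [piC_chart_right, piC_chart_left]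
    have h := tsum_latticeKernel_mul (stripRegular_S N (-(finSite N c)) (-x)) (stripRegular_S N (-z) (-(finSite N c))) hκ 0
    simp_rw [zero_sub] at h
    rw [← h, ← tsum_mul_left]
    exact tsum_congr fun Y => by ring
  have hsum : ∀ c : Fin (d + 1) → Fin N,
      Summable fun Y : Fin (d + 1) → ℤ => piC N x ((N : ℤ) • Y + finSite N c) * piC N ((N : ℤ) • Y + finSite N c) z := by
    intro c
    simp_rw [piC_chart_right, piC_chart_left]
    have h := summable_latticeKernel_mul (stripRegular_S N (-(finSite N c)) (-x)) (stripRegular_S N (-z) (-(finSite N c))) hκ 0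
    simp_rw [zero_sub] at h
    exact (h.mul_left (C * C)).congr fun Y => by ring
  rw [Summable.tsum_finsetSum (fun c _ => hsum c)]
  simp_rw [hblock]
  rw [← Finset.mul_sum]
  -- linearity of the lattice kernel over the offsets, then the symbol identity on the real zone
  have hint : ∀ c ∈ (Finset.univ : Finset (Fin (d + 1) → Fin N)),
      IntegrableOn (integrand (fun k => S N (-(finSite N c)) (-x) k * S N (-z) (-(finSite N c)) k) 0) (BZ (d + 1)) := by
    intro c _
    exact ((stripRegular_S N (-(finSite N c)) (-x)).mul (stripRegular_S N (-z) (-(finSite N c)))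
      (stripRegular_nonneg (stripRegular_S N (-(finSite N c)) (-x)) hκ.le)).integrableOn hκ.le 0
  have hlin := latticeKernel_sum_mul Finset.univ (fun _ => (1 : ℂ))
    (fun c k => S N (-(finSite N c)) (-x) k * S N (-z) (-(finSite N c)) k) 0 hint
  simp only [one_mul] at hlin
  rw [← hlin]
  have hcongr : latticeKernel (fun k => ∑ c : Fin (d + 1) → Fin N, S N (-(finSite N c)) (-x) k * S N (-z) (-(finSite N c)) k) 0
      = latticeKernel (fun k => ((N : ℂ) ^ (d + 1)) * S N (-z) (-x) k) 0 :=
    latticeKernel_congr (fun p hp => sum_S_mul_S N (ofRealVec_mem_Fat hp) x z) 0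
  rw [hcongr]
  unfold piC
  have hcm : latticeKernel (fun k => ((N : ℂ) ^ (d + 1)) * S N (-z) (-x) k) 0 = ((N : ℂ) ^ (d + 1)) * latticeKernel (fun k => S N (-z) (-x) k) 0 := by
    have h1 := latticeKernel_sum_mul ({(0 : Unit)} : Finset Unit) (fun _ => ((N : ℂ) ^ (d + 1))) (fun _ k => S N (-z) (-x) k) 0
      (fun _ _ => (stripRegular_S N (-z) (-x)).integrableOn hκ.le 0)
    simpa using h1
  rw [hcm, hC]
  field_simp

end Idempotence

end Summit.QuantumFields.BalabanUV.Beta.FP.SliceProjectorKernel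

end
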